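import Literature.MathematicalPhysics.QuantumFieldTheory.Balaban1983to89.Node00.OpsYCubeDirInverseBond
import Literature.MathematicalPhysics.QuantumFieldTheory.Balaban1983to89.B9Eq3105ZetaY
import Literature.MathematicalPhysics.QuantumFieldTheory.Balaban1983to89.B9WalkLettersOps310

/-!
# `Balaban1983to89.B9Eq3105CoordsDirichletBondY` — T. Bałaban, *Propagators for lattice gauge theories in a background field*, Commun. Math. Phys. **99** (1985)
# 389–434 [Balaban1985BackgroundPropagators] (3.105) p. 414 («Δ_aG₀ = Σ_□ h_□² − Σ_□ K(h_□)G_□h_□ − Σ_□ (1 − ζ_□̃)DPD*h_□G_□h_□ − Σ_□ ζ_□̃D(P − P_□)D*h_□G_□h_□ − Σ_□ ζ_□̃P₁(∂h_□)G_□h_□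
# = I − R»), (3.87) p. 409, p. 409 l. 3–5 («G_□(U)»), (3.42) p. 397, (3.101) p. 414, p. 415: ★★ **(3.105) AND ITS TRANSPOSE IN THE rows-19 WALK RECORD's COORDINATE LETTERS,
# AT PRINT's DIRICHLET BOND LETTERS `G_□(U) = GDirBY …` AND PRINT's PINS `Pl_□ = DP_□D*`, `ζ_□̃ = zetaY`, WITH THE FOUR FAMILIES NAMED** — the `hlawsA`.3∕.4 rows of the N06 knit
# certificate («KE₁₂X-A» ∕ «KESC-AF») at the pin `ΔaA := S0coKq …`, `OcA □ := GDirBY …`, `RfA ∕ RtA := eq3105FamQY ∕ eq3105FamQTY`.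

statement-level skeleton of published theorems with citation tags; proofs where landed; nothing here is a claim about the Yang–Mills mass gap

WHAT.  node00-def-Y's ✓`Node00.OpsYCubeDirInverseBond.eq3105Q_hT_GDirBY_DPDsY` ∕ `eq3105QT_hT_GDirBY` (the identity (3.105) at `Δ_a[𝔮]` with the cube letters
`G_□(U) = GDirBY i 𝔮 𝔮⋆ (DPDsY i parS G′_□) B_□ U` — print's `(Ω₀Δ_{a,□}Ω₀)⁻¹` for the sequence, local-inverse law DISCHARGED — over dag-n06-j's ✓`B9Eq3105OfLocalInverseQ`) is an
identity of `ℂ`-linear operators on bond fields.  The N06 heads display it in the walk record's REAL COORDINATES (`S0coKq = c_R⁻¹·φ(Δ_a[𝔮])`, `GcoK (G_□) = c_R·φ(G_□)`,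
`mulOp h_□ = φ(M_{h_□})`, `φ = coordAlgHomB i b`, ✓`B9Eq3105OfLocalInverseQ` §4) with the remainder written `1 − Σ_a R(U)a` over ONE finite index.  THIS FILE names the four
families over the index `□ ⊕ □ ⊕ □ ⊕ □` and restates the identity in exactly that currency:
* §1 defs ★ `eq3105FamQY` (the four printed families `φ(K[𝔮](h_□)G_□h_□)`, `φ((1 − ζ_□̃)DPD*(h_□G_□h_□))`, `φ(ζ_□̃(DPD* − DP_□D*)(h_□G_□h_□))`, `φ(ζ_□̃P₁(∂h_□)G_□h_□)` as ONE
  family on `□ ⊕ □ ⊕ □ ⊕ □`) and `eq3105FamQTY` (the transposed reading's families, signed so that the identity reads `… = 1 − Σ`), `sum_eq3105FamQY` ∕ `sum_eq3105FamQTY`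
  (the `Sum.elim` bookkeeping).
* §3 `eq3105Q(T)_coords_GDirBY_member`: the same at a k-level member with the record's partition letter `hWalkBY x □` (the heads' syntactic form).
* §2 ★★ `eq3105Q_coords_GDirBY` ∕ ★★ `eq3105QT_coords_GDirBY`: `S0coKq … U * Σ_□ mulOp h_□ * GcoK (G_□) U * mulOp h_□ = 1 − Σ_a eq3105FamQY … a` and its transpose, displayed
  premises ONLY `hB` (bond support of `h_□` inside `B_□`) and the regime `hU : IsUnit (padDeltaLocBY …)` (Thm 3.3 ∕ Cor. 3.6 for the sequence — NOT in the tree at `U ≠ 1`,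
  dag-n06-j's located obstruction 2026-08-31: `curv2Y` is unsigned); `ζ_□̃ := zetaY i □` (lit ✓`B9Eq3105ZetaY`, `hζ` by ✓`zetaY_eq_one_of_hTY_ne_zero`).
* §4–§5 (v1.1, the (β) letter of the N06 desk) ★ `eq3105FamQCY` ∕ `eq3105FamQTCY`: the same four families with a PER-CUBE averaging transporter `parC □` inside print's
  `P_□` (node00-def-Y's `parKnitCubeY i □` — the cube sequence's own knit legs, p. 409 l. 1–5), the physical `DPD*` keeping `parS`; `eq3105FamQ(T)CY_const` (v1 = constant case);
  ★★ `eq3105Q(T)_coords_GDirBY_parC` and the member editions `eq3105Q(T)_coords_GDirBY_member_parC` (def-Y's generic ✓`eq3105Q_hT_GDirBY` ∕ ✓`eq3105QT_hT_GDirBY`).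
HONEST SCOPE.  Identities and bookkeeping over landed letters (v1: 2 `def` + 4 thm; v1.1: + 2 `def` + 8 thm; 0 `sorry`); no estimate — the SIZE of the four families ((3.89)∕(3.106): «R satisfies (3.85) with
O(M⁻¹)») is the certificate's displayed `hfacA`; count-neutral; N06 NOT discharged; nothing continuum ∕ OS ∕ mass gap ∕ Clay.  Cell `pub-ymgap` (D-0062), node N06 [B9], seat
`pub-ymgap-dag-n06-d` (g32), 2026-08-31; NEW file; nothing landed is modified.
-/

noncomputable section

namespace Literature.MathematicalPhysics.QuantumFieldTheory.Balaban1983to89.B9Eq3105CoordsDirichletBondY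

open Node00
open B9Thm37Sum (mulOp)
open B9Thm37CubeCoverCommutators (cutMulY hTY)
open B9Eq3104CutoffCommutators (hBdY DPDsY P1Y DPDsY_comp_cutMulY)
open B9Eq3105OfLocalInverseQ (KhBQY S0coKq_eq_smul_coordAlgHomB GcoK_eq_smul_coordAlgHomB smul_mul_sum_smul_eq sum_smul_mul_smul_eq)
open B9Eq3105ZetaY (zetaY zetaY_eq_one_of_hTY_ne_zero)
open B9Thm39ReadingCoords (cR39)
open B9CoReadingCoords (XBK GcoK)
open B9WalkLettersBondLeib (coordAlgHomB mulOp_bond_eq_coordOpK)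
open B6KLevelCensusIndexV1 (KIdx)
open B6Cover236MultiLevelBlocks (cubes)
open Node00.OpsYNablaBridge (chartY)
open Node00.OpsYQLetter (QLetterY QsLetterY)
open Node00.OpsYOps312OfRecordPar (S0coKq)
open Node00.OpsYCubeDirInverseBond (GDirBY padDeltaLocBY eq3105Q_hT_GDirBY_DPDsY eq3105QT_hT_GDirBY)
open scoped Matrix

variable {d ℓ : ℕ} {hd : 1 ≤ d + 1} {hL : Odd (ℓ + 1) ∧ 1 < ℓ + 1} {b₀ b₁ : ℝ}
variable {𝔸 : Type} [NormedRing 𝔸] [NormedAlgebra ℂ 𝔸] [CompleteSpace 𝔸] [FiniteDimensional ℝ 𝔸] {κ : Type} [Fintype κ]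
variable (i : KIdx d ℓ hd hL b₀ b₁) (b : Module.Basis κ ℝ 𝔸)

/-! ## §1 The four families of (3.105) at the Dirichlet bond letters, as ONE family over `□ ⊕ □ ⊕ □ ⊕ □` -/

section Families

variable (𝔮 : QLetterY 𝔸 i) (𝔮s : QsLetterY 𝔸 i) (parS : SiteParY 𝔸 i) (Gp : SiteOpY 𝔸 i)
  (Gpc : ↥(cubes i.D.toDomains) → SiteOpY 𝔸 i) (Bc : ↥(cubes i.D.toDomains) → Finset (FBondY i)) (U : CfgY 𝔸 i)

/-- ★ **THE FOUR FAMILIES OF (3.105) IN COORDINATES** at `G_□(U) = GDirBY i 𝔮 𝔮⋆ (DP_□D*) B_□ U`, `Pl_□ = DPDsY parS G′_□`, `ζ_□̃ = zetaY i □`: for `a = □` in the k-th summand,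
`k = 1`: `φ(K[𝔮](h_□)G_□M_{h_□})`; `k = 2`: `φ((1 − M_{ζ})DPD*(U)(M_hG_□M_h))`; `k = 3`: `φ(M_ζ(DPD*(U) − DP_□D*(U))(M_hG_□M_h))`; `k = 4`: `φ(M_ζP₁(∂h_□)G_□M_h)` — print's
`R¹ … R⁴` (p.414 l.−6 «= I − R»). [cite: Balaban1985BackgroundPropagators, (3.105) p.414, (3.87) p.409, (3.101) p.414] -/
def eq3105FamQY : ↥(cubes i.D.toDomains) ⊕ ↥(cubes i.D.toDomains) ⊕ ↥(cubes i.D.toDomains) ⊕ ↥(cubes i.D.toDomains) → Module.End ℝ (XBK κ i → ℝ) :=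
  Sum.elim (fun c => coordAlgHomB i b (KhBQY i (hTY i c) 𝔮 𝔮s U * GDirBY i 𝔮 𝔮s (DPDsY i parS (Gpc c)) (Bc c) U * cutMulY (hBdY i (hTY i c))))
    (Sum.elim (fun c => coordAlgHomB i b ((1 - cutMulY (hBdY i (zetaY i c))) * DPDsY i parS Gp U *
        (cutMulY (hBdY i (hTY i c)) * GDirBY i 𝔮 𝔮s (DPDsY i parS (Gpc c)) (Bc c) U * cutMulY (hBdY i (hTY i c)))))
      (Sum.elim (fun c => coordAlgHomB i b (cutMulY (hBdY i (zetaY i c)) * (DPDsY i parS Gp U - DPDsY i parS (Gpc c) U) *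
          (cutMulY (hBdY i (hTY i c)) * GDirBY i 𝔮 𝔮s (DPDsY i parS (Gpc c)) (Bc c) U * cutMulY (hBdY i (hTY i c)))))
        (fun c => coordAlgHomB i b (cutMulY (hBdY i (zetaY i c)) * P1Y i (hTY i c) parS (Gpc c) U *
          GDirBY i 𝔮 𝔮s (DPDsY i parS (Gpc c)) (Bc c) U * cutMulY (hBdY i (hTY i c))))))

/-- the TRANSPOSED reading's four families (signed so that the transposed identity reads `… = 1 − Σ_a`): `−φ(M_hG_□K[𝔮](h_□))`, `−φ(M_hG_□P₁(∂h_□))`,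
`φ(M_hG_□M_h·M_ζ(DPD* − DP_□D*))`, `φ(M_hG_□M_h·(1 − M_ζ)DPD*)` (transposed reading — bookkeeping; print displays only the left form of (3.105)).
[cite: Balaban1985BackgroundPropagators, (3.105) p.414, (3.87) p.409, (3.101) p.414] -/
def eq3105FamQTY : ↥(cubes i.D.toDomains) ⊕ ↥(cubes i.D.toDomains) ⊕ ↥(cubes i.D.toDomains) ⊕ ↥(cubes i.D.toDomains) → Module.End ℝ (XBK κ i → ℝ) :=
  Sum.elim (fun c => -coordAlgHomB i b (cutMulY (hBdY i (hTY i c)) * GDirBY i 𝔮 𝔮s (DPDsY i parS (Gpc c)) (Bc c) U * KhBQY i (hTY i c) 𝔮 𝔮s U))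
    (Sum.elim (fun c => -coordAlgHomB i b (cutMulY (hBdY i (hTY i c)) * GDirBY i 𝔮 𝔮s (DPDsY i parS (Gpc c)) (Bc c) U * P1Y i (hTY i c) parS (Gpc c) U))
      (Sum.elim (fun c => coordAlgHomB i b (cutMulY (hBdY i (hTY i c)) * GDirBY i 𝔮 𝔮s (DPDsY i parS (Gpc c)) (Bc c) U * cutMulY (hBdY i (hTY i c)) *
          (cutMulY (hBdY i (zetaY i c)) * (DPDsY i parS Gp U - DPDsY i parS (Gpc c) U))))
        (fun c => coordAlgHomB i b (cutMulY (hBdY i (hTY i c)) * GDirBY i 𝔮 𝔮s (DPDsY i parS (Gpc c)) (Bc c) U * cutMulY (hBdY i (hTY i c)) *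
          ((1 - cutMulY (hBdY i (zetaY i c))) * DPDsY i parS Gp U)))))

omit [FiniteDimensional ℝ 𝔸] in
/-- the `Sum.elim` bookkeeping: `Σ_a eq3105FamQY a = Σ_□ R¹_□ + (Σ_□ R²_□ + (Σ_□ R³_□ + Σ_□ R⁴_□))`. [cite: Balaban1985BackgroundPropagators, (3.105) p.414, bookkeeping] -/
theorem sum_eq3105FamQY :
    ∑ a, eq3105FamQY i b 𝔮 𝔮s parS Gp Gpc Bc U a =
      ∑ c, coordAlgHomB i b (KhBQY i (hTY i c) 𝔮 𝔮s U * GDirBY i 𝔮 𝔮s (DPDsY i parS (Gpc c)) (Bc c) U * cutMulY (hBdY i (hTY i c)))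
        + (∑ c, coordAlgHomB i b ((1 - cutMulY (hBdY i (zetaY i c))) * DPDsY i parS Gp U *
            (cutMulY (hBdY i (hTY i c)) * GDirBY i 𝔮 𝔮s (DPDsY i parS (Gpc c)) (Bc c) U * cutMulY (hBdY i (hTY i c))))
        + (∑ c, coordAlgHomB i b (cutMulY (hBdY i (zetaY i c)) * (DPDsY i parS Gp U - DPDsY i parS (Gpc c) U) *
            (cutMulY (hBdY i (hTY i c)) * GDirBY i 𝔮 𝔮s (DPDsY i parS (Gpc c)) (Bc c) U * cutMulY (hBdY i (hTY i c))))
        + ∑ c, coordAlgHomB i b (cutMulY (hBdY i (zetaY i c)) * P1Y i (hTY i c) parS (Gpc c) U *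
            GDirBY i 𝔮 𝔮s (DPDsY i parS (Gpc c)) (Bc c) U * cutMulY (hBdY i (hTY i c))))) := by
  simp only [eq3105FamQY, Fintype.sum_sum_type, Sum.elim_inl, Sum.elim_inr]

omit [FiniteDimensional ℝ 𝔸] in
/-- the same for the transposed families. [cite: Balaban1985BackgroundPropagators, (3.105) p.414, bookkeeping] -/
theorem sum_eq3105FamQTY :
    ∑ a, eq3105FamQTY i b 𝔮 𝔮s parS Gp Gpc Bc U a =
      ∑ c, -coordAlgHomB i b (cutMulY (hBdY i (hTY i c)) * GDirBY i 𝔮 𝔮s (DPDsY i parS (Gpc c)) (Bc c) U * KhBQY i (hTY i c) 𝔮 𝔮s U)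
        + (∑ c, -coordAlgHomB i b (cutMulY (hBdY i (hTY i c)) * GDirBY i 𝔮 𝔮s (DPDsY i parS (Gpc c)) (Bc c) U * P1Y i (hTY i c) parS (Gpc c) U)
        + (∑ c, coordAlgHomB i b (cutMulY (hBdY i (hTY i c)) * GDirBY i 𝔮 𝔮s (DPDsY i parS (Gpc c)) (Bc c) U * cutMulY (hBdY i (hTY i c)) *
            (cutMulY (hBdY i (zetaY i c)) * (DPDsY i parS Gp U - DPDsY i parS (Gpc c) U)))
        + ∑ c, coordAlgHomB i b (cutMulY (hBdY i (hTY i c)) * GDirBY i 𝔮 𝔮s (DPDsY i parS (Gpc c)) (Bc c) U * cutMulY (hBdY i (hTY i c)) *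
            ((1 - cutMulY (hBdY i (zetaY i c))) * DPDsY i parS Gp U)))) := by
  simp only [eq3105FamQTY, Fintype.sum_sum_type, Sum.elim_inl, Sum.elim_inr]

end Families

/-! ## §2 (3.105) and its transpose in the record's coordinates at the Dirichlet bond letters -/

section Coords

variable (B : B9.Backgrounds) (cfg : B.Cfg → CfgY 𝔸 i)
variable (𝔮 : QLetterY 𝔸 i) (𝔮s : QsLetterY 𝔸 i) (parS : SiteParY 𝔸 i) (Gp : SiteOpY 𝔸 i)

/-- ★★ **(3.105) IN THE WALK RECORD's COORDINATES AT PRINT's DIRICHLET BOND LETTERS**: with `h_□` read on the bond carrier, `Δ_a[𝔮]` as `S0coKq … Gp`, the cube letters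
`G_□(U) = GDirBY i 𝔮 𝔮⋆ (DP_□D*) B_□` read as `GcoK`, and `ζ_□̃ = zetaY i □`:
`S0coKq U · Σ_□ mulOp h_□ · GcoK(G_□) U · mulOp h_□ = 1 − Σ_a eq3105FamQY … a` — the `hlawsA`.3 row of «KE₁₂X-A»∕«KESC-AF» at the pin.  Displayed premises: the bond support of
`h_□` inside `B_□` and the regime `IsUnit (padDeltaLocBY …)` (Thm 3.3 ∕ Cor. 3.6 for the sequence).
[cite: Balaban1985BackgroundPropagators, (3.105) p.414, (3.87) p.409, p.409 l.3–5, (3.42) p.397, p.415] -/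
theorem eq3105Q_coords_GDirBY (hc : cR39 b ≠ 0) (U₁ : B.Cfg) (Gpc : ↥(cubes i.D.toDomains) → SiteOpY 𝔸 i)
    (Bc : ↥(cubes i.D.toDomains) → Finset (FBondY i)) (hB : ∀ c bd, hBdY i (hTY i c) bd ≠ 0 → bd ∈ Bc c)
    (hU : ∀ c, IsUnit (padDeltaLocBY i 𝔮 𝔮s (DPDsY i parS (Gpc c)) (Bc c) (cfg U₁))) :
    S0coKq i b B cfg 𝔮 𝔮s parS Gp U₁ *
        (∑ c, mulOp (fun p : XBK κ i => hTY i c (chartY i p.1.src)) * GcoK i b B cfg (GDirBY i 𝔮 𝔮s (DPDsY i parS (Gpc c)) (Bc c)) U₁ *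
          mulOp (fun p : XBK κ i => hTY i c (chartY i p.1.src))) =
      1 - ∑ a, eq3105FamQY i b 𝔮 𝔮s parS Gp Gpc Bc (cfg U₁) a := by
  have eM : ∀ c : ↥(cubes i.D.toDomains),
      mulOp (fun p : XBK κ i => hTY i c (chartY i p.1.src)) = coordAlgHomB i b (cutMulY (𝔸 := 𝔸) (hBdY i (hTY i c))) :=
    fun c => mulOp_bond_eq_coordOpK i b (hTY i c)
  simp only [eM, S0coKq_eq_smul_coordAlgHomB, GcoK_eq_smul_coordAlgHomB]
  rw [smul_mul_sum_smul_eq i b hc, eq3105Q_hT_GDirBY_DPDsY i 𝔮 𝔮s parS Gp (cfg U₁) (fun c => zetaY i c)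
    (fun c z hz => zetaY_eq_one_of_hTY_ne_zero i c hz) Gpc Bc hB hU, sum_eq3105FamQY]
  simp only [map_sub, map_sum, map_one]
  abel

/-- ★★ **THE TRANSPOSED (3.105) IN THE SAME CURRENCY**: `Σ_□ mulOp h_□ · GcoK(G_□) U · mulOp h_□ · S0coKq U = 1 − Σ_a eq3105FamQTY … a` — the `hlawsA`.4 row at the pin
(`Pl_□ := DP_□D*`, `P₁(∂h_□) := P1Y …`, the (3.101) row by ✓`DPDsY_comp_cutMulY`). (transposed reading — bookkeeping)
[cite: Balaban1985BackgroundPropagators, (3.105) p.414, (3.87) p.409, p.409 l.3–5, (3.101) p.414] -/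
theorem eq3105QT_coords_GDirBY (hc : cR39 b ≠ 0) (U₁ : B.Cfg) (Gpc : ↥(cubes i.D.toDomains) → SiteOpY 𝔸 i)
    (Bc : ↥(cubes i.D.toDomains) → Finset (FBondY i)) (hB : ∀ c bd, hBdY i (hTY i c) bd ≠ 0 → bd ∈ Bc c)
    (hU : ∀ c, IsUnit (padDeltaLocBY i 𝔮 𝔮s (DPDsY i parS (Gpc c)) (Bc c) (cfg U₁))) :
    (∑ c, mulOp (fun p : XBK κ i => hTY i c (chartY i p.1.src)) * GcoK i b B cfg (GDirBY i 𝔮 𝔮s (DPDsY i parS (Gpc c)) (Bc c)) U₁ *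
          mulOp (fun p : XBK κ i => hTY i c (chartY i p.1.src))) * S0coKq i b B cfg 𝔮 𝔮s parS Gp U₁ =
      1 - ∑ a, eq3105FamQTY i b 𝔮 𝔮s parS Gp Gpc Bc (cfg U₁) a := by
  have eM : ∀ c : ↥(cubes i.D.toDomains),
      mulOp (fun p : XBK κ i => hTY i c (chartY i p.1.src)) = coordAlgHomB i b (cutMulY (𝔸 := 𝔸) (hBdY i (hTY i c))) :=
    fun c => mulOp_bond_eq_coordOpK i b (hTY i c)
  simp only [eM, S0coKq_eq_smul_coordAlgHomB, GcoK_eq_smul_coordAlgHomB]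
  rw [sum_smul_mul_smul_eq i b hc, eq3105QT_hT_GDirBY i 𝔮 𝔮s parS Gp (cfg U₁) (fun c => zetaY i c)
    (fun c z hz => zetaY_eq_one_of_hTY_ne_zero i c hz) (fun c => DPDsY i parS (Gpc c)) (fun c => P1Y i (hTY i c) parS (Gpc c) (cfg U₁))
    (fun c => DPDsY_comp_cutMulY i (hTY i c) parS (Gpc c) (cfg U₁)) Bc hB hU, sum_eq3105FamQTY]
  simp only [map_sub, map_add, map_sum, map_one, Finset.sum_neg_distrib]
  abel

end Coords

/-! ## §3 At a k-level member, with the rows-19 record's partition letter `hWalkBY x □` (syntactic form of the heads' `hlawsA`.3∕.4) -/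

section Member

open B9PinMembersKLevelV1 (MemberY)
open B9WalkLettersOps310 (hWalkBY)

variable {Mstar : ℕ} (x : MemberY d ℓ hd hL b₀ b₁ Mstar) (B : B9.Backgrounds) (cfg : B.Cfg → CfgY 𝔸 x.toKIdx)
variable (𝔮 : QLetterY 𝔸 x.toKIdx) (𝔮s : QsLetterY 𝔸 x.toKIdx) (parS : SiteParY 𝔸 x.toKIdx) (Gp : SiteOpY 𝔸 x.toKIdx)

/-- ★★ (3.105) in the rows-19 record's coordinates AT A MEMBER, the partition read as the record's `hWalkBY x □` (= `fun p => h_□(chart p₋)` by `rfl`) — the heads' `hlawsA`.3 shape.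
[cite: Balaban1985BackgroundPropagators, (3.105) p.414, (3.87) p.409, p.409 l.3–5] -/
theorem eq3105Q_coords_GDirBY_member (hc : cR39 b ≠ 0) (U₁ : B.Cfg) (Gpc : ↥(cubes x.toKIdx.D.toDomains) → SiteOpY 𝔸 x.toKIdx)
    (Bc : ↥(cubes x.toKIdx.D.toDomains) → Finset (FBondY x.toKIdx)) (hB : ∀ c bd, hBdY x.toKIdx (hTY x.toKIdx c) bd ≠ 0 → bd ∈ Bc c)
    (hU : ∀ c, IsUnit (padDeltaLocBY x.toKIdx 𝔮 𝔮s (DPDsY x.toKIdx parS (Gpc c)) (Bc c) (cfg U₁))) :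
    S0coKq x.toKIdx b B cfg 𝔮 𝔮s parS Gp U₁ *
        (∑ c, mulOp (hWalkBY (κ := κ) x c) * GcoK x.toKIdx b B cfg (GDirBY x.toKIdx 𝔮 𝔮s (DPDsY x.toKIdx parS (Gpc c)) (Bc c)) U₁ * mulOp (hWalkBY (κ := κ) x c)) =
      1 - ∑ a, eq3105FamQY x.toKIdx b 𝔮 𝔮s parS Gp Gpc Bc (cfg U₁) a :=
  eq3105Q_coords_GDirBY x.toKIdx b B cfg 𝔮 𝔮s parS Gp hc U₁ Gpc Bc hB hU

/-- ★★ the transposed reading at a member, same currency. (transposed reading — bookkeeping)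
[cite: Balaban1985BackgroundPropagators, (3.105) p.414, (3.87) p.409, p.409 l.3–5] -/
theorem eq3105QT_coords_GDirBY_member (hc : cR39 b ≠ 0) (U₁ : B.Cfg) (Gpc : ↥(cubes x.toKIdx.D.toDomains) → SiteOpY 𝔸 x.toKIdx)
    (Bc : ↥(cubes x.toKIdx.D.toDomains) → Finset (FBondY x.toKIdx)) (hB : ∀ c bd, hBdY x.toKIdx (hTY x.toKIdx c) bd ≠ 0 → bd ∈ Bc c)
    (hU : ∀ c, IsUnit (padDeltaLocBY x.toKIdx 𝔮 𝔮s (DPDsY x.toKIdx parS (Gpc c)) (Bc c) (cfg U₁))) :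
    (∑ c, mulOp (hWalkBY (κ := κ) x c) * GcoK x.toKIdx b B cfg (GDirBY x.toKIdx 𝔮 𝔮s (DPDsY x.toKIdx parS (Gpc c)) (Bc c)) U₁ * mulOp (hWalkBY (κ := κ) x c)) *
        S0coKq x.toKIdx b B cfg 𝔮 𝔮s parS Gp U₁ =
      1 - ∑ a, eq3105FamQTY x.toKIdx b 𝔮 𝔮s parS Gp Gpc Bc (cfg U₁) a :=
  eq3105QT_coords_GDirBY x.toKIdx b B cfg 𝔮 𝔮s parS Gp hc U₁ Gpc Bc hB hU

end Member

/-! ## §4 (v1.1) The families with a PER-CUBE averaging transporter: print's `P_□` built on the cube sequence's own knit letter (`parKnitCubeY □`) -/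

section FamiliesC

variable (𝔮 : QLetterY 𝔸 i) (𝔮s : QsLetterY 𝔸 i) (parS : SiteParY 𝔸 i) (Gp : SiteOpY 𝔸 i)
  (parC : ↥(cubes i.D.toDomains) → SiteParY 𝔸 i) (Gpc : ↥(cubes i.D.toDomains) → SiteOpY 𝔸 i)
  (Bc : ↥(cubes i.D.toDomains) → Finset (FBondY i)) (U : CfgY 𝔸 i)

/-- ★ (v1.1) **THE FOUR FAMILIES OF (3.105) WITH A PER-CUBE TRANSPORTER**: as `eq3105FamQY`, but print's `P_□` («constructed for the sequence {Ω_n(□)}», p. 409 l. 1–5) reads its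
averaging legs from a cube-indexed table `parC □` (node00-def-Y's `parKnitCubeY i □`, `Node00.OpsYCubeKnitPar` — the (β) letter of the N06 desk), while the PHYSICAL `P` of `DPD*`
keeps the member table `parS`: `Pl_□ := DPDsY (parC □) G′_□`, `P₁(∂h_□) := P1Y h_□ (parC □) G′_□`.  The v1 families are the constant case `parC := fun _ => parS` (`eq3105FamQCY_const`).
[cite: Balaban1985BackgroundPropagators, (3.105) p.414, (3.87) p.409, p.409 l.1–5, (3.101) p.414, (3.19) p.393] -/
def eq3105FamQCY : ↥(cubes i.D.toDomains) ⊕ ↥(cubes i.D.toDomains) ⊕ ↥(cubes i.D.toDomains) ⊕ ↥(cubes i.D.toDomains) → Module.End ℝ (XBK κ i → ℝ) :=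
  Sum.elim (fun c => coordAlgHomB i b (KhBQY i (hTY i c) 𝔮 𝔮s U * GDirBY i 𝔮 𝔮s (DPDsY i (parC c) (Gpc c)) (Bc c) U * cutMulY (hBdY i (hTY i c))))
    (Sum.elim (fun c => coordAlgHomB i b ((1 - cutMulY (hBdY i (zetaY i c))) * DPDsY i parS Gp U *
        (cutMulY (hBdY i (hTY i c)) * GDirBY i 𝔮 𝔮s (DPDsY i (parC c) (Gpc c)) (Bc c) U * cutMulY (hBdY i (hTY i c)))))
      (Sum.elim (fun c => coordAlgHomB i b (cutMulY (hBdY i (zetaY i c)) * (DPDsY i parS Gp U - DPDsY i (parC c) (Gpc c) U) *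
          (cutMulY (hBdY i (hTY i c)) * GDirBY i 𝔮 𝔮s (DPDsY i (parC c) (Gpc c)) (Bc c) U * cutMulY (hBdY i (hTY i c)))))
        (fun c => coordAlgHomB i b (cutMulY (hBdY i (zetaY i c)) * P1Y i (hTY i c) (parC c) (Gpc c) U *
          GDirBY i 𝔮 𝔮s (DPDsY i (parC c) (Gpc c)) (Bc c) U * cutMulY (hBdY i (hTY i c))))))

/-- (v1.1) the TRANSPOSED reading's four families with a per-cube transporter (signed so that the transposed identity reads `… = 1 − Σ_a`). (transposed reading — bookkeeping)
[cite: Balaban1985BackgroundPropagators, (3.105) p.414, (3.87) p.409, (3.101) p.414] -/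
def eq3105FamQTCY : ↥(cubes i.D.toDomains) ⊕ ↥(cubes i.D.toDomains) ⊕ ↥(cubes i.D.toDomains) ⊕ ↥(cubes i.D.toDomains) → Module.End ℝ (XBK κ i → ℝ) :=
  Sum.elim (fun c => -coordAlgHomB i b (cutMulY (hBdY i (hTY i c)) * GDirBY i 𝔮 𝔮s (DPDsY i (parC c) (Gpc c)) (Bc c) U * KhBQY i (hTY i c) 𝔮 𝔮s U))
    (Sum.elim (fun c => -coordAlgHomB i b (cutMulY (hBdY i (hTY i c)) * GDirBY i 𝔮 𝔮s (DPDsY i (parC c) (Gpc c)) (Bc c) U * P1Y i (hTY i c) (parC c) (Gpc c) U))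
      (Sum.elim (fun c => coordAlgHomB i b (cutMulY (hBdY i (hTY i c)) * GDirBY i 𝔮 𝔮s (DPDsY i (parC c) (Gpc c)) (Bc c) U * cutMulY (hBdY i (hTY i c)) *
          (cutMulY (hBdY i (zetaY i c)) * (DPDsY i parS Gp U - DPDsY i (parC c) (Gpc c) U))))
        (fun c => coordAlgHomB i b (cutMulY (hBdY i (hTY i c)) * GDirBY i 𝔮 𝔮s (DPDsY i (parC c) (Gpc c)) (Bc c) U * cutMulY (hBdY i (hTY i c)) *
          ((1 - cutMulY (hBdY i (zetaY i c))) * DPDsY i parS Gp U)))))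

omit [FiniteDimensional ℝ 𝔸] in
/-- dictionary: at the constant table `parC := fun _ => parS` the v1.1 families ARE the v1 families. [cite: Balaban1985BackgroundPropagators, (3.105) p.414, bookkeeping] -/
theorem eq3105FamQCY_const : eq3105FamQCY i b 𝔮 𝔮s parS Gp (fun _ => parS) Gpc Bc U = eq3105FamQY i b 𝔮 𝔮s parS Gp Gpc Bc U := rfl

omit [FiniteDimensional ℝ 𝔸] in
/-- dictionary, transposed families. [cite: Balaban1985BackgroundPropagators, (3.105) p.414, bookkeeping] -/
theorem eq3105FamQTCY_const : eq3105FamQTCY i b 𝔮 𝔮s parS Gp (fun _ => parS) Gpc Bc U = eq3105FamQTY i b 𝔮 𝔮s parS Gp Gpc Bc U := rfl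

omit [FiniteDimensional ℝ 𝔸] in
/-- the `Sum.elim` bookkeeping for the v1.1 families. [cite: Balaban1985BackgroundPropagators, (3.105) p.414, bookkeeping] -/
theorem sum_eq3105FamQCY :
    ∑ a, eq3105FamQCY i b 𝔮 𝔮s parS Gp parC Gpc Bc U a =
      ∑ c, coordAlgHomB i b (KhBQY i (hTY i c) 𝔮 𝔮s U * GDirBY i 𝔮 𝔮s (DPDsY i (parC c) (Gpc c)) (Bc c) U * cutMulY (hBdY i (hTY i c)))
        + (∑ c, coordAlgHomB i b ((1 - cutMulY (hBdY i (zetaY i c))) * DPDsY i parS Gp U *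
            (cutMulY (hBdY i (hTY i c)) * GDirBY i 𝔮 𝔮s (DPDsY i (parC c) (Gpc c)) (Bc c) U * cutMulY (hBdY i (hTY i c))))
        + (∑ c, coordAlgHomB i b (cutMulY (hBdY i (zetaY i c)) * (DPDsY i parS Gp U - DPDsY i (parC c) (Gpc c) U) *
            (cutMulY (hBdY i (hTY i c)) * GDirBY i 𝔮 𝔮s (DPDsY i (parC c) (Gpc c)) (Bc c) U * cutMulY (hBdY i (hTY i c))))
        + ∑ c, coordAlgHomB i b (cutMulY (hBdY i (zetaY i c)) * P1Y i (hTY i c) (parC c) (Gpc c) U *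
            GDirBY i 𝔮 𝔮s (DPDsY i (parC c) (Gpc c)) (Bc c) U * cutMulY (hBdY i (hTY i c))))) := by
  simp only [eq3105FamQCY, Fintype.sum_sum_type, Sum.elim_inl, Sum.elim_inr]

omit [FiniteDimensional ℝ 𝔸] in
/-- the same for the transposed v1.1 families. [cite: Balaban1985BackgroundPropagators, (3.105) p.414, bookkeeping] -/
theorem sum_eq3105FamQTCY :
    ∑ a, eq3105FamQTCY i b 𝔮 𝔮s parS Gp parC Gpc Bc U a =
      ∑ c, -coordAlgHomB i b (cutMulY (hBdY i (hTY i c)) * GDirBY i 𝔮 𝔮s (DPDsY i (parC c) (Gpc c)) (Bc c) U * KhBQY i (hTY i c) 𝔮 𝔮s U)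
        + (∑ c, -coordAlgHomB i b (cutMulY (hBdY i (hTY i c)) * GDirBY i 𝔮 𝔮s (DPDsY i (parC c) (Gpc c)) (Bc c) U * P1Y i (hTY i c) (parC c) (Gpc c) U)
        + (∑ c, coordAlgHomB i b (cutMulY (hBdY i (hTY i c)) * GDirBY i 𝔮 𝔮s (DPDsY i (parC c) (Gpc c)) (Bc c) U * cutMulY (hBdY i (hTY i c)) *
            (cutMulY (hBdY i (zetaY i c)) * (DPDsY i parS Gp U - DPDsY i (parC c) (Gpc c) U)))
        + ∑ c, coordAlgHomB i b (cutMulY (hBdY i (hTY i c)) * GDirBY i 𝔮 𝔮s (DPDsY i (parC c) (Gpc c)) (Bc c) U * cutMulY (hBdY i (hTY i c)) *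
            ((1 - cutMulY (hBdY i (zetaY i c))) * DPDsY i parS Gp U)))) := by
  simp only [eq3105FamQTCY, Fintype.sum_sum_type, Sum.elim_inl, Sum.elim_inr]

end FamiliesC

/-! ## §5 (v1.1) (3.105) and its transpose in the record's coordinates at the Dirichlet bond letters with the per-cube transporter; the member editions -/

section CoordsC

variable (B : B9.Backgrounds) (cfg : B.Cfg → CfgY 𝔸 i)
variable (𝔮 : QLetterY 𝔸 i) (𝔮s : QsLetterY 𝔸 i) (parS : SiteParY 𝔸 i) (Gp : SiteOpY 𝔸 i) (parC : ↥(cubes i.D.toDomains) → SiteParY 𝔸 i)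

/-- ★★ (v1.1) **(3.105) IN THE WALK RECORD's COORDINATES AT PRINT's DIRICHLET BOND LETTERS WITH `P_□ = DP_□D*` ON THE CUBE's OWN TRANSPORTER**:
`S0coKq U · Σ_□ mulOp h_□ · GcoK(G_□) U · mulOp h_□ = 1 − Σ_a eq3105FamQCY … a`, `G_□ = GDirBY 𝔮 𝔮⋆ (DPDsY (parC □) G′_□) B_□` (def-Y's generic ✓`eq3105Q_hT_GDirBY` with
`Pl_□ := DPDsY (parC □) G′_□`, the (3.101) row ✓`DPDsY_comp_cutMulY` at `parC □`).  Displayed premises: the bond support of `h_□` inside `B_□` and the regime `IsUnit (padDeltaLocBY …)`.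
[cite: Balaban1985BackgroundPropagators, (3.105) p.414, (3.87) p.409, p.409 l.1–5, (3.42) p.397, p.415] -/
theorem eq3105Q_coords_GDirBY_parC (hc : cR39 b ≠ 0) (U₁ : B.Cfg) (Gpc : ↥(cubes i.D.toDomains) → SiteOpY 𝔸 i)
    (Bc : ↥(cubes i.D.toDomains) → Finset (FBondY i)) (hB : ∀ c bd, hBdY i (hTY i c) bd ≠ 0 → bd ∈ Bc c)
    (hU : ∀ c, IsUnit (padDeltaLocBY i 𝔮 𝔮s (DPDsY i (parC c) (Gpc c)) (Bc c) (cfg U₁))) :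
    S0coKq i b B cfg 𝔮 𝔮s parS Gp U₁ *
        (∑ c, mulOp (fun p : XBK κ i => hTY i c (chartY i p.1.src)) * GcoK i b B cfg (GDirBY i 𝔮 𝔮s (DPDsY i (parC c) (Gpc c)) (Bc c)) U₁ *
          mulOp (fun p : XBK κ i => hTY i c (chartY i p.1.src))) =
      1 - ∑ a, eq3105FamQCY i b 𝔮 𝔮s parS Gp parC Gpc Bc (cfg U₁) a := by
  have eM : ∀ c : ↥(cubes i.D.toDomains),
      mulOp (fun p : XBK κ i => hTY i c (chartY i p.1.src)) = coordAlgHomB i b (cutMulY (𝔸 := 𝔸) (hBdY i (hTY i c))) :=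
    fun c => mulOp_bond_eq_coordOpK i b (hTY i c)
  simp only [eM, S0coKq_eq_smul_coordAlgHomB, GcoK_eq_smul_coordAlgHomB]
  rw [smul_mul_sum_smul_eq i b hc, Node00.OpsYCubeDirInverseBond.eq3105Q_hT_GDirBY i 𝔮 𝔮s parS Gp (cfg U₁) (fun c => zetaY i c)
    (fun c z hz => zetaY_eq_one_of_hTY_ne_zero i c hz) (fun c => DPDsY i (parC c) (Gpc c)) (fun c => P1Y i (hTY i c) (parC c) (Gpc c) (cfg U₁))
    (fun c => DPDsY_comp_cutMulY i (hTY i c) (parC c) (Gpc c) (cfg U₁)) Bc hB hU, sum_eq3105FamQCY]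
  simp only [map_sub, map_sum, map_one]
  abel

/-- ★★ (v1.1) **THE TRANSPOSED (3.105) IN THE SAME CURRENCY WITH THE PER-CUBE TRANSPORTER**: `Σ_□ mulOp h_□ · GcoK(G_□) U · mulOp h_□ · S0coKq U = 1 − Σ_a eq3105FamQTCY … a`.
(transposed reading — bookkeeping) [cite: Balaban1985BackgroundPropagators, (3.105) p.414, (3.87) p.409, p.409 l.1–5, (3.101) p.414] -/
theorem eq3105QT_coords_GDirBY_parC (hc : cR39 b ≠ 0) (U₁ : B.Cfg) (Gpc : ↥(cubes i.D.toDomains) → SiteOpY 𝔸 i)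
    (Bc : ↥(cubes i.D.toDomains) → Finset (FBondY i)) (hB : ∀ c bd, hBdY i (hTY i c) bd ≠ 0 → bd ∈ Bc c)
    (hU : ∀ c, IsUnit (padDeltaLocBY i 𝔮 𝔮s (DPDsY i (parC c) (Gpc c)) (Bc c) (cfg U₁))) :
    (∑ c, mulOp (fun p : XBK κ i => hTY i c (chartY i p.1.src)) * GcoK i b B cfg (GDirBY i 𝔮 𝔮s (DPDsY i (parC c) (Gpc c)) (Bc c)) U₁ *
          mulOp (fun p : XBK κ i => hTY i c (chartY i p.1.src))) * S0coKq i b B cfg 𝔮 𝔮s parS Gp U₁ =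
      1 - ∑ a, eq3105FamQTCY i b 𝔮 𝔮s parS Gp parC Gpc Bc (cfg U₁) a := by
  have eM : ∀ c : ↥(cubes i.D.toDomains),
      mulOp (fun p : XBK κ i => hTY i c (chartY i p.1.src)) = coordAlgHomB i b (cutMulY (𝔸 := 𝔸) (hBdY i (hTY i c))) :=
    fun c => mulOp_bond_eq_coordOpK i b (hTY i c)
  simp only [eM, S0coKq_eq_smul_coordAlgHomB, GcoK_eq_smul_coordAlgHomB]
  rw [sum_smul_mul_smul_eq i b hc, eq3105QT_hT_GDirBY i 𝔮 𝔮s parS Gp (cfg U₁) (fun c => zetaY i c)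
    (fun c z hz => zetaY_eq_one_of_hTY_ne_zero i c hz) (fun c => DPDsY i (parC c) (Gpc c)) (fun c => P1Y i (hTY i c) (parC c) (Gpc c) (cfg U₁))
    (fun c => DPDsY_comp_cutMulY i (hTY i c) (parC c) (Gpc c) (cfg U₁)) Bc hB hU, sum_eq3105FamQTCY]
  simp only [map_sub, map_add, map_sum, map_one, Finset.sum_neg_distrib]
  abel

end CoordsC

section MemberC

open B9PinMembersKLevelV1 (MemberY)
open B9WalkLettersOps310 (hWalkBY)

variable {Mstar : ℕ} (x : MemberY d ℓ hd hL b₀ b₁ Mstar) (B : B9.Backgrounds) (cfg : B.Cfg → CfgY 𝔸 x.toKIdx)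
variable (𝔮 : QLetterY 𝔸 x.toKIdx) (𝔮s : QsLetterY 𝔸 x.toKIdx) (parS : SiteParY 𝔸 x.toKIdx) (Gp : SiteOpY 𝔸 x.toKIdx)
  (parC : ↥(cubes x.toKIdx.D.toDomains) → SiteParY 𝔸 x.toKIdx)

/-- ★★ (v1.1) (3.105) in the rows-19 record's coordinates AT A MEMBER with the per-cube transporter, the partition read as `hWalkBY x □` — the heads' `hlawsA`.3 shape at the (β) pins.
[cite: Balaban1985BackgroundPropagators, (3.105) p.414, (3.87) p.409, p.409 l.1–5] -/
theorem eq3105Q_coords_GDirBY_member_parC (hc : cR39 b ≠ 0) (U₁ : B.Cfg) (Gpc : ↥(cubes x.toKIdx.D.toDomains) → SiteOpY 𝔸 x.toKIdx)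
    (Bc : ↥(cubes x.toKIdx.D.toDomains) → Finset (FBondY x.toKIdx)) (hB : ∀ c bd, hBdY x.toKIdx (hTY x.toKIdx c) bd ≠ 0 → bd ∈ Bc c)
    (hU : ∀ c, IsUnit (padDeltaLocBY x.toKIdx 𝔮 𝔮s (DPDsY x.toKIdx (parC c) (Gpc c)) (Bc c) (cfg U₁))) :
    S0coKq x.toKIdx b B cfg 𝔮 𝔮s parS Gp U₁ *
        (∑ c, mulOp (hWalkBY (κ := κ) x c) * GcoK x.toKIdx b B cfg (GDirBY x.toKIdx 𝔮 𝔮s (DPDsY x.toKIdx (parC c) (Gpc c)) (Bc c)) U₁ *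
          mulOp (hWalkBY (κ := κ) x c)) =
      1 - ∑ a, eq3105FamQCY x.toKIdx b 𝔮 𝔮s parS Gp parC Gpc Bc (cfg U₁) a :=
  eq3105Q_coords_GDirBY_parC x.toKIdx b B cfg 𝔮 𝔮s parS Gp parC hc U₁ Gpc Bc hB hU

/-- ★★ (v1.1) the transposed reading at a member with the per-cube transporter — the heads' `hlawsA`.4 shape at the (β) pins. (transposed reading — bookkeeping)
[cite: Balaban1985BackgroundPropagators, (3.105) p.414, (3.87) p.409, p.409 l.1–5] -/
theorem eq3105QT_coords_GDirBY_member_parC (hc : cR39 b ≠ 0) (U₁ : B.Cfg) (Gpc : ↥(cubes x.toKIdx.D.toDomains) → SiteOpY 𝔸 x.toKIdx)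
    (Bc : ↥(cubes x.toKIdx.D.toDomains) → Finset (FBondY x.toKIdx)) (hB : ∀ c bd, hBdY x.toKIdx (hTY x.toKIdx c) bd ≠ 0 → bd ∈ Bc c)
    (hU : ∀ c, IsUnit (padDeltaLocBY x.toKIdx 𝔮 𝔮s (DPDsY x.toKIdx (parC c) (Gpc c)) (Bc c) (cfg U₁))) :
    (∑ c, mulOp (hWalkBY (κ := κ) x c) * GcoK x.toKIdx b B cfg (GDirBY x.toKIdx 𝔮 𝔮s (DPDsY x.toKIdx (parC c) (Gpc c)) (Bc c)) U₁ * mulOp (hWalkBY (κ := κ) x c)) *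
        S0coKq x.toKIdx b B cfg 𝔮 𝔮s parS Gp U₁ =
      1 - ∑ a, eq3105FamQTCY x.toKIdx b 𝔮 𝔮s parS Gp parC Gpc Bc (cfg U₁) a :=
  eq3105QT_coords_GDirBY_parC x.toKIdx b B cfg 𝔮 𝔮s parS Gp parC hc U₁ Gpc Bc hB hU

end MemberC

end Literature.MathematicalPhysics.QuantumFieldTheory.Balaban1983to89.B9Eq3105CoordsDirichletBondY

end
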